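import Mathlib
import HarnessLib
import Summits.Ventures.LatticeQCDFlow.Exactness.NCMCGeneralSpaceSampleSize
import Summits.Ventures.LatticeQCDFlow.Exactness.NCMCGeneralSpaceMarkovRun

/-!
# NCMCGeneralSpaceSampleSizeMarginals — the NECESSITY half of the importance-sampling sample-size
# law holds WITHOUT INDEPENDENCE on a general state space: any joint law of `N` draws whose
# one-draw marginals are the proposal (e.g. records launched from a stationary restart chain)

HONEST FRAMING: exact (Metropolis-corrected) sampling algorithms for lattice gauge theory;
figures of merit are autocorrelation/cost numbers at stated couplings and volumes; no
continuum-physics claim.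

Venture `LatticeQCDFlow` (cell pub-lqcd); FANOUT row 19 (`su2-snf`, GEN-7; §3 GEN-8), next to row 13's
`Exactness/NCMCGeneralSpace*` series.  OUR WORK (general measure theory, elementary); nothing is
cited as a fact.  The Literature's Chatterjee–Diaconis theorem
(`Literature/Probability/ImportanceSampling/ChatterjeeDiaconis`, Ann. Appl. Probab. 28 (2018)
Thm 1.1) is stated — as printed — for i.i.d. draws; its necessity half, read line by line
(§4 of the paper: a union bound over the draws, Markov's inequality under the proposal, and
Markov's inequality for the truncated estimator), uses only that EACH draw has the proposal law.
This file proves that half in that generality (the finite-sum version is this seat's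
`Scaling/SampleSizeIdenticalMarginals`) and docks it to row 13's Crooks pairs.

* **`sampleSize_necessary_of_marginals`** — probability measures `ν ≪ μ` on `𝓧`, `ρ = dν/dμ`,
  `L = ∫ log ρ dν`; ANY finite measure `Q` on `Fin N → 𝓧` with `Q ∘ (x ↦ xᵢ)⁻¹ = μ` for every `i`;
  any real `t` with `N ≤ e^{L − t}` and any `δ < 1`:
  `Q{ (1/N) Σᵢ ρ(xᵢ) ≥ 1 − δ } ≤ e^{−t/2} + ν{ ρ ≤ e^{L − t/2} }/(1 − δ)`;
* **`CrooksPair.sampleSize_necessary_of_marginals`** — for a Crooks pair (`P_F`, `P_R`,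
  `e^{−ΔF} = Z₁/Z₀`) and ANY joint law `Q` of `N` forward records with `P_F` marginals:
  `N ≤ exp(E_{P_R}[ΔF − W] − t)` ⇒
  `Q{ (1/N)Σᵢ e^{ΔF − W(εᵢ)} ≥ 1 − δ } ≤ e^{−t/2} + P_R{ ΔF − W ≤ E_{P_R}[ΔF − W] − t/2 }/(1 − δ)` —
  `Exactness/NCMCGeneralSpaceSampleSize.sampleSize_necessary` verbatim, minus independence.

* **`CrooksPair.sampleSize_necessary_restartChain`** (GEN-8) — the engine's equilibrium RESTART
  CHAIN of forward records (row 13's `Exactness/NCMCGeneralSpaceMarkovRun`, any `ν₀`-invariant level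
  sampler `K`, any `n_between`): the same necessity bound for `N` consecutive evolutions, with NO
  mixing hypothesis — correlated launches never need fewer evolutions than the marginal law allows.

NOT CLAIMED: the sufficiency half for dependent draws (needs a variance / mixing input — GEN-8's
`Exactness/NCMCGeneralSpaceSampleSizeVarianceInflation` / `…RestartChainSampleSize`); the
`ν`-a.e. reformulation `{ρ ≤ a} = {log ρ ≤ log a}` of the first tail (immediate, not needed for
the docking where `ρ = e^{ΔF − W} > 0`).
-/

namespace Summit.Ventures.LatticeQCDFlow.Exactness.GeneralNCMC

open MeasureTheory ProbabilityTheory Set Filter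
open scoped ENNReal

/-! ## §1 Importance sampling: necessity from identical marginals -/

section General

variable {𝓧 : Type*} [MeasurableSpace 𝓧]

/-- **IMPORTANCE-SAMPLING SAMPLE SIZE, NECESSITY, IDENTICAL MARGINALS (general state space).**
For probability measures `ν ≪ μ`, `ρ = dν/dμ`, `L = ∫ log ρ dν`, a finite measure `Q` on
`Fin N → 𝓧` all of whose one-draw marginals are `μ`, any `t` with `N ≤ e^{L − t}` and any `δ < 1`:
`Q{(1/N)Σᵢ ρ(xᵢ) ≥ 1 − δ} ≤ e^{−t/2} + ν{ρ ≤ e^{L − t/2}}/(1 − δ)`. -/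
theorem sampleSize_necessary_of_marginals (μ ν : Measure 𝓧) [IsProbabilityMeasure μ]
    [IsProbabilityMeasure ν] (hνμ : ν ≪ μ) {N : ℕ} (Q : Measure (Fin N → 𝓧)) [IsFiniteMeasure Q]
    (hmarg : ∀ i : Fin N, Q.map (fun x => x i) = μ) {t : ℝ}
    (hN : (N : ℝ) ≤ Real.exp ((∫ y, Real.log (ν.rnDeriv μ y).toReal ∂ν) - t))
    {δ : ℝ} (hδ1 : δ < 1) :
    Q.real {x | 1 - δ ≤ (1 / (N : ℝ)) * ∑ i, (ν.rnDeriv μ (x i)).toReal}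
      ≤ Real.exp (-t / 2)
        + ν.real {y | (ν.rnDeriv μ y).toReal
            ≤ Real.exp ((∫ y, Real.log (ν.rnDeriv μ y).toReal ∂ν) - t / 2)} / (1 - δ) := by
  set L := ∫ y, Real.log (ν.rnDeriv μ y).toReal ∂ν with hL
  set a := Real.exp (L - t / 2) with ha
  have ha0 : 0 < a := Real.exp_pos _
  set ρ : 𝓧 → ℝ := fun y => (ν.rnDeriv μ y).toReal with hρ
  have hρm : Measurable ρ := (Measure.measurable_rnDeriv ν μ).ennreal_toReal
  have hρ0 : ∀ y, 0 ≤ ρ y := fun y => ENNReal.toReal_nonneg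
  have hRHS0 : 0 ≤ Real.exp (-t / 2) + ν.real {y | ρ y ≤ a} / (1 - δ) :=
    add_nonneg (Real.exp_pos _).le (div_nonneg measureReal_nonneg (by linarith))
  -- the degenerate empty sample
  rcases Nat.eq_zero_or_pos N with hN0 | hNpos
  · subst hN0
    have hempty : {x : Fin 0 → 𝓧 | 1 - δ ≤ (1 / ((0 : ℕ) : ℝ)) * ∑ i, ρ (x i)} = ∅ := by
      ext x
      simp only [CharP.cast_eq_zero, div_zero, zero_mul, mem_setOf_eq, mem_empty_iff_false,
        iff_false, not_le]
      linarith
    rw [hempty, measureReal_empty]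
    exact hRHS0
  have hNr : (0 : ℝ) < N := Nat.cast_pos.mpr hNpos
  -- the truncated estimator `Z(x) = (1/N) Σ_i ρ(x i) 1{ρ(x i) ≤ a}`
  let g : 𝓧 → ℝ := fun y => if ρ y ≤ a then ρ y else 0
  have hgdef : ∀ y, g y = if ρ y ≤ a then ρ y else 0 := fun y => rfl
  have hgm : Measurable g := Measurable.ite (hρm measurableSet_Iic) hρm measurable_const
  have hg0 : ∀ y, 0 ≤ g y := fun y => by rw [hgdef]; split_ifs; exacts [hρ0 y, le_rfl]
  have hga : ∀ y, g y ≤ a := fun y => by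
    rw [hgdef]; split_ifs with h; exacts [h, ha0.le]
  let Z : (Fin N → 𝓧) → ℝ := fun x => (1 / (N : ℝ)) * ∑ i, g (x i)
  have hZdef : ∀ x, Z x = (1 / (N : ℝ)) * ∑ i, g (x i) := fun x => rfl
  have hZm : Measurable Z :=
    measurable_const.mul (Finset.measurable_sum _ fun i _ => hgm.comp (measurable_pi_apply i))
  have hZ0 : ∀ x, 0 ≤ Z x := fun x => mul_nonneg (by positivity) (Finset.sum_nonneg fun i _ => hg0 _)
  have hZa : ∀ x, Z x ≤ a := fun x => by
    rw [hZdef]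
    calc (1 / (N : ℝ)) * ∑ i, g (x i) ≤ (1 / (N : ℝ)) * ∑ _i : Fin N, a :=
          mul_le_mul_of_nonneg_left (Finset.sum_le_sum fun i _ => hga _) (by positivity)
      _ = a := by
          rw [Finset.sum_const, Finset.card_univ, Fintype.card_fin, nsmul_eq_mul]
          field_simp
  -- Step 1: the event is contained in `{∃ i, a < ρ(x i)} ∪ {1 − δ ≤ Z}`
  have hsub : {x : Fin N → 𝓧 | 1 - δ ≤ (1 / (N : ℝ)) * ∑ i, ρ (x i)}
      ⊆ (⋃ i : Fin N, {x | a < ρ (x i)}) ∪ {x | 1 - δ ≤ Z x} := by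
    intro x hx
    by_cases hex : ∃ i, a < ρ (x i)
    · obtain ⟨i, hi⟩ := hex
      exact Or.inl (mem_iUnion.mpr ⟨i, hi⟩)
    · right
      simp only [not_exists, not_lt] at hex
      have hZx : Z x = (1 / (N : ℝ)) * ∑ i, ρ (x i) := by
        rw [hZdef]
        congr 1
        exact Finset.sum_congr rfl fun i _ => by rw [hgdef, if_pos (hex i)]
      show 1 - δ ≤ Z x
      rw [hZx]; exact hx
  -- Step 2: the union bound and Markov under `μ`
  have hterm1 : Q.real (⋃ i : Fin N, {x | a < ρ (x i)}) ≤ Real.exp (-t / 2) := by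
    have hone : ∀ i : Fin N, Q.real {x | a < ρ (x i)} ≤ 1 / a := by
      intro i
      have hle : Q {x | a < ρ (x i)} ≤ μ {y | a < ρ y} := by
        rw [← hmarg i]
        exact Measure.le_map_apply (measurable_pi_apply i).aemeasurable _
      have hμ : μ.real {y | a < ρ y} ≤ 1 / a := by
        have hmk := mul_meas_ge_le_integral_of_nonneg (μ := μ) (f := ρ)
          (Eventually.of_forall hρ0) (Measure.integrable_toReal_rnDeriv) a
        have hint : ∫ y, ρ y ∂μ ≤ 1 := by
          rw [hρ, Measure.integral_toReal_rnDeriv hνμ]; simp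
        have hsub' : {y | a < ρ y} ⊆ {y | a ≤ ρ y} := fun y hy => by
          simp only [mem_setOf_eq] at hy ⊢; exact hy.le
        calc μ.real {y | a < ρ y} ≤ μ.real {y | a ≤ ρ y} := measureReal_mono hsub'
          _ ≤ 1 / a := by
              rw [le_div_iff₀ ha0, mul_comm]; exact hmk.trans hint
      calc Q.real {x | a < ρ (x i)} ≤ μ.real {y | a < ρ y} := by
            exact ENNReal.toReal_mono (measure_ne_top _ _) hle
        _ ≤ 1 / a := hμ
    calc Q.real (⋃ i : Fin N, {x | a < ρ (x i)})
        ≤ ∑ i : Fin N, Q.real {x | a < ρ (x i)} := measureReal_iUnion_fintype_le _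
      _ ≤ ∑ _i : Fin N, 1 / a := Finset.sum_le_sum fun i _ => hone i
      _ = (N : ℝ) / a := by
          rw [Finset.sum_const, Finset.card_univ, Fintype.card_fin, nsmul_eq_mul, mul_one_div]
      _ ≤ Real.exp (L - t) / a := div_le_div_of_nonneg_right hN ha0.le
      _ = Real.exp (-t / 2) := by rw [ha, ← Real.exp_sub]; congr 1; ring
  -- Step 3: Markov for `Z` under `Q`, and `E_Q Z = ν{ρ ≤ a}` by the marginals
  have hZint : Integrable Z Q :=
    (integrable_const a).mono' hZm.aestronglyMeasurable
      (Eventually.of_forall fun x => by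
        rw [Real.norm_eq_abs, abs_of_nonneg (hZ0 x)]; exact hZa x)
  have hEZ : ∫ x, Z x ∂Q = ν.real {y | ρ y ≤ a} := by
    have hgi : ∀ i : Fin N, ∫ x, g (x i) ∂Q = ν.real {y | ρ y ≤ a} := by
      intro i
      have h1 : ∫ x, g (x i) ∂Q = ∫ y, g y ∂(Q.map fun x => x i) := by
        rw [integral_map (measurable_pi_apply i).aemeasurable hgm.aestronglyMeasurable]
      rw [h1, hmarg i]
      have hms : MeasurableSet {y | ρ y ≤ a} := hρm measurableSet_Iic
      have h2 : ∫ y, g y ∂μ = ∫ y in {y | ρ y ≤ a}, ρ y ∂μ := by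
        rw [← integral_indicator hms]
        try exact integral_congr_ae (Eventually.of_forall fun y => by
          rw [hgdef]
          by_cases hy : ρ y ≤ a
          · rw [if_pos hy, indicator_of_mem (by exact hy)]
          · rw [if_neg hy, indicator_of_notMem (by exact hy)])
      rw [h2, hρ, Measure.setIntegral_toReal_rnDeriv hνμ]
    have hgint : ∀ i : Fin N, Integrable (fun x : Fin N → 𝓧 => g (x i)) Q := fun i =>
      (integrable_const a).mono' (hgm.comp (measurable_pi_apply i)).aestronglyMeasurable
        (Eventually.of_forall fun x => by
          rw [Real.norm_eq_abs, abs_of_nonneg (hg0 _)]; exact hga _)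
    calc ∫ x, Z x ∂Q = (1 / (N : ℝ)) * ∑ i, ∫ x, g (x i) ∂Q := by
          rw [← integral_finsetSum _ fun i _ => hgint i, ← integral_const_mul]
      _ = ν.real {y | ρ y ≤ a} := by
          simp_rw [hgi]
          rw [Finset.sum_const, Finset.card_univ, Fintype.card_fin, nsmul_eq_mul, ← mul_assoc,
            one_div_mul_cancel hNr.ne', one_mul]
  have hterm2 : Q.real {x | 1 - δ ≤ Z x} ≤ ν.real {y | ρ y ≤ a} / (1 - δ) := by
    have hmk := mul_meas_ge_le_integral_of_nonneg (μ := Q) (f := Z)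
      (Eventually.of_forall hZ0) hZint (1 - δ)
    rw [le_div_iff₀ (by linarith), mul_comm, ← hEZ]
    exact hmk
  -- assemble
  calc Q.real {x | 1 - δ ≤ (1 / (N : ℝ)) * ∑ i, ρ (x i)}
      ≤ Q.real ((⋃ i : Fin N, {x | a < ρ (x i)}) ∪ {x | 1 - δ ≤ Z x}) := measureReal_mono hsub
    _ ≤ Q.real (⋃ i : Fin N, {x | a < ρ (x i)}) + Q.real {x | 1 - δ ≤ Z x} :=
        measureReal_union_le _ _
    _ ≤ Real.exp (-t / 2) + ν.real {y | ρ y ≤ a} / (1 - δ) := add_le_add hterm1 hterm2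

end General

/-! ## §2 Crooks pairs: correlated forward records with `P_F` marginals -/

variable {Ω E : Type*} [MeasurableSpace Ω] [MeasurableSpace E]

namespace CrooksPair

variable {ν₀ ν₁ : Measure Ω} {κF κR : Kernel Ω E} {s e : E → Ω} {W : E → ℝ}

/-- **JARZYNSKI SAMPLE SIZE, NECESSITY, WITHOUT INDEPENDENCE (general state space).**  For a
Crooks pair and ANY finite measure `Q` on `Fin N → E` whose one-record marginals are all `P_F`
(e.g. the joint law of the records launched from a stationary prior chain), any `t` with
`N ≤ exp(E_{P_R}[ΔF − W] − t)` and any `δ < 1`: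
`Q{ (1/N)Σᵢ e^{ΔF − W(εᵢ)} ≥ 1 − δ } ≤ e^{−t/2} + P_R{ ΔF − W ≤ E_{P_R}[ΔF − W] − t/2 }/(1 − δ)`. -/
theorem sampleSize_necessary_of_marginals [IsFiniteMeasure ν₀] [IsFiniteMeasure ν₁]
    [IsMarkovKernel κF] [IsMarkovKernel κR] (h0 : ν₀ univ ≠ 0) (h1 : ν₁ univ ≠ 0)
    (h : CrooksPair ν₀ ν₁ κF κR s e W) {ΔF : ℝ}
    (hΔF : Real.exp (-ΔF) = ((ν₀ univ)⁻¹ * ν₁ univ).toReal) {N : ℕ}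
    (Q : Measure (Fin N → E)) [IsFiniteMeasure Q]
    (hmarg : ∀ i : Fin N, Q.map (fun x => x i) = fwdPathLaw ν₀ κF) {t : ℝ}
    (hN : (N : ℝ) ≤ Real.exp ((∫ ε, (ΔF - W ε) ∂(fwdPathLaw ν₁ κR)) - t))
    {δ : ℝ} (hδ1 : δ < 1) :
    Q.real {x | 1 - δ ≤ (1 / (N : ℝ)) * ∑ i, Real.exp (ΔF - W (x i))}
      ≤ Real.exp (-t / 2)
        + (fwdPathLaw ν₁ κR).real
            {ε | ΔF - W ε ≤ (∫ ε', (ΔF - W ε') ∂(fwdPathLaw ν₁ κR)) - t / 2} / (1 - δ) := by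
  haveI := isProbabilityMeasure_fwdPathLaw ν₀ h0 κF
  haveI := isProbabilityMeasure_fwdPathLaw ν₁ h1 κR
  have hkl := h.integral_log_rnDeriv_rev_fwd h0 h1 hΔF
  have hgen := GeneralNCMC.sampleSize_necessary_of_marginals (fwdPathLaw ν₀ κF) (fwdPathLaw ν₁ κR)
    (h.revPathLaw_absolutelyContinuous h0 h1) Q hmarg (t := t) (by rwa [hkl]) hδ1
  rw [hkl] at hgen
  -- the event, up to a `Q`-null set (each coordinate's density is `e^{ΔF − W}` `P_F`-a.e.)
  have hae : ∀ᵐ x ∂Q, ∀ i : Fin N,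
      ((fwdPathLaw ν₁ κR).rnDeriv (fwdPathLaw ν₀ κF) (x i)).toReal = Real.exp (ΔF - W (x i)) := by
    rw [ae_all_iff]
    intro i
    have hq : Measure.QuasiMeasurePreserving (fun x : Fin N → E => x i) Q (fwdPathLaw ν₀ κF) := by
      refine ⟨measurable_pi_apply i, ?_⟩
      rw [hmarg i]
    filter_upwards [hq.ae_eq (h.rnDeriv_rev_fwd_ae h0 h1 hΔF)] with x hx
    have hx' : (fwdPathLaw ν₁ κR).rnDeriv (fwdPathLaw ν₀ κF) (x i)
        = ENNReal.ofReal (Real.exp (ΔF - W (x i))) := hx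
    rw [hx', ENNReal.toReal_ofReal (Real.exp_pos _).le]
  have hev : {x : Fin N → E | 1 - δ ≤ (1 / (N : ℝ)) * ∑ i,
        ((fwdPathLaw ν₁ κR).rnDeriv (fwdPathLaw ν₀ κF) (x i)).toReal}
      =ᵐ[Q] ({x : Fin N → E | 1 - δ ≤ (1 / (N : ℝ)) * ∑ i, Real.exp (ΔF - W (x i))} : Set _) := by
    filter_upwards [hae] with x hx
    simp only [eq_iff_iff]
    dsimp only [setOf]
    rw [Finset.sum_congr rfl fun i _ => hx i]
  -- the tail event, up to a `P_R`-null set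
  have htail : {ε | ((fwdPathLaw ν₁ κR).rnDeriv (fwdPathLaw ν₀ κF) ε).toReal
        ≤ Real.exp ((∫ ε', (ΔF - W ε') ∂(fwdPathLaw ν₁ κR)) - t / 2)}
      =ᵐ[fwdPathLaw ν₁ κR]
        ({ε | ΔF - W ε ≤ (∫ ε', (ΔF - W ε') ∂(fwdPathLaw ν₁ κR)) - t / 2} : Set E) := by
    filter_upwards [(h.revPathLaw_absolutelyContinuous h0 h1).ae_eq
      (h.rnDeriv_rev_fwd_ae h0 h1 hΔF)] with ε hε
    simp only [eq_iff_iff]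
    dsimp only [setOf]
    rw [hε, ENNReal.toReal_ofReal (Real.exp_pos _).le, Real.exp_le_exp]
  rw [measureReal_congr hev, measureReal_congr htail] at hgen
  exact hgen

/-! ## §3 The engine's restart chain: necessity with NO mixing input -/

/-- **JARZYNSKI SAMPLE SIZE ALONG THE RESTART CHAIN, NECESSITY — no mixing hypothesis at all.**
For a Crooks pair and ANY `ν₀`-invariant Markov level sampler `K` between launches (any
`n_between`, even `K = Kernel.id`), along the equilibrium restart chain of forward records
(`Exactness/NCMCGeneralSpaceMarkovRun`; every one-record marginal is `P_F`): if
`N ≤ exp(E_{P_R}[ΔF − W] − t)` then for every `δ < 1`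
`P( (1/N)Σ_{i<N} e^{ΔF − W(εᵢ)} ≥ 1 − δ ) ≤ e^{−t/2} + P_R{ΔF − W ≤ E_{P_R}[ΔF − W] − t/2}/(1 − δ)` —
correlations between launches can only make the sample-size requirement WORSE, never better than
the marginal law allows. -/
theorem sampleSize_necessary_restartChain (K : Kernel Ω Ω) [IsMarkovKernel K]
    [IsFiniteMeasure ν₀] [IsFiniteMeasure ν₁] [IsMarkovKernel κF] [IsMarkovKernel κR]
    (h0 : ν₀ univ ≠ 0) (h1 : ν₁ univ ≠ 0) (hK : Kernel.Invariant K ν₀)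
    (h : CrooksPair ν₀ ν₁ κF κR s e W) {ΔF : ℝ}
    (hΔF : Real.exp (-ΔF) = ((ν₀ univ)⁻¹ * ν₁ univ).toReal) {N : ℕ} {t : ℝ}
    (hN : (N : ℝ) ≤ Real.exp ((∫ ε, (ΔF - W ε) ∂(fwdPathLaw ν₁ κR)) - t))
    {δ : ℝ} (hδ1 : δ < 1) :
    haveI := isProbabilityMeasure_fwdPathLaw ν₀ h0 κF
    (Kernel.trajMeasure (X := fun _ : ℕ => E) (fwdPathLaw ν₀ κF)
        (fun n : ℕ => ((κF ∘ₖ K).comap s h.measurable_s).comap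
          (fun hh : (j : ↥(Finset.Iic n)) → E => hh ⟨n, Finset.mem_Iic.2 le_rfl⟩)
          (measurable_pi_apply _))).real
      {x : ℕ → E | 1 - δ ≤ (1 / (N : ℝ)) * ∑ i ∈ Finset.range N, Real.exp (ΔF - W (x i))}
      ≤ Real.exp (-t / 2)
        + (fwdPathLaw ν₁ κR).real
            {ε | ΔF - W ε ≤ (∫ ε', (ΔF - W ε') ∂(fwdPathLaw ν₁ κR)) - t / 2} / (1 - δ) := by
  haveI := isProbabilityMeasure_fwdPathLaw ν₀ h0 κF
  set R := (κF ∘ₖ K).comap s h.measurable_s with hR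
  set P := Kernel.trajMeasure (X := fun _ : ℕ => E) (fwdPathLaw ν₀ κF)
      (fun n : ℕ => R.comap (fun hh : (j : ↥(Finset.Iic n)) → E => hh ⟨n, Finset.mem_Iic.2 le_rfl⟩)
        (measurable_pi_apply _)) with hP
  have hW := h.measurable_W
  have hr : Measurable (fun (x : ℕ → E) (j : Fin N) => x j) :=
    measurable_pi_lambda _ fun j => measurable_pi_apply _
  set Q := P.map (fun (x : ℕ → E) (j : Fin N) => x j) with hQ
  haveI : IsFiniteMeasure Q := Measure.isFiniteMeasure_map P _
  have hmarg : ∀ i : Fin N, Q.map (fun y => y i) = fwdPathLaw ν₀ κF := fun i => by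
    rw [hQ, Measure.map_map (measurable_pi_apply i) hr, hP]
    exact h.restartChain_map_eval K h0 hK i
  have key := h.sampleSize_necessary_of_marginals h0 h1 hΔF Q hmarg hN hδ1
  -- pull the event back to the trajectory measure
  have hSm : MeasurableSet {y : Fin N → E | 1 - δ ≤ (1 / (N : ℝ)) * ∑ i, Real.exp (ΔF - W (y i))} :=
    measurableSet_le measurable_const (measurable_const.mul (Finset.measurable_sum _ fun i _ =>
      Real.measurable_exp.comp (measurable_const.sub (hW.comp (measurable_pi_apply i)))))
  rw [hQ, map_measureReal_apply hr hSm] at key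
  have hpre : (fun (x : ℕ → E) (j : Fin N) => x j) ⁻¹'
        {y : Fin N → E | 1 - δ ≤ (1 / (N : ℝ)) * ∑ i, Real.exp (ΔF - W (y i))}
      = {x : ℕ → E | 1 - δ ≤ (1 / (N : ℝ)) * ∑ i ∈ Finset.range N, Real.exp (ΔF - W (x i))} := by
    ext x
    simp only [Set.mem_preimage, Set.mem_setOf_eq]
    rw [Fin.sum_univ_eq_sum_range (fun i => Real.exp (ΔF - W (x i))) N]
  rw [hpre] at key
  exact key

end CrooksPair

end Summit.Ventures.LatticeQCDFlow.Exactness.GeneralNCMC
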